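import Literature.AlgebraicGeometry.HodgeTheory.QuaternionicQuarticFermatMemberChartOne
import HarnessLib

/-!
# The double-plane branch configurations `(s³ − s)·y·Ψ` and `(s³ − s)·Φ` are nodal under three checkable conditions

Layer `Literature/AlgebraicGeometry/HodgeTheory`, namespace `Literature.AlgebraicGeometry.HodgeTheory.Q8Family` (sequel of
`QuaternionicQuarticFermatMemberChartOne`, whose `grad_cubic`, `isNodal_cubic`, `isNodal_cubic_mul_X_one` it reuses). Theorems only, over `ℂ`; no definition, no named fact. Written by the prover seat
`leafhand-hodge-q8symplecticpowers-4` (g5, cell `pub-hsemireg`) for the openness step (T3) of the S1 programme of route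
`HodgeConjecture/Q8SymplecticPowers` (crux K1Q, stmt-HodgeConjecture-24190): in EVERY chart of `𝔽₂` and for EVERY parameter `a` (not only
the Fermat member of `QuaternionicQuarticFermatMember*`), the branch curve of the route's double plane is, up to a non-zero constant,
`(s³ − s)·y·Ψ` (charts `U₁, U₂`) or `(s³ − s)·Φ` (charts `U₃, U₄`) with `Ψ, Φ` the chart transforms of `Ψ₂(a)`. The two lemmas below
reduce «nodal» for such a configuration to three checkable conditions on the last factor — it is nodal (e.g. smooth), it misses the
line `y = 0` (first shape only), and `∂_yΨ ≠ 0` (resp. `∂_vΦ ≠ 0`) at its points on the three lines `s ∈ {0, 1, −1}` — which is the form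
in which the successor proves them on a Zariski-open set of parameters. [Fulton2008, §3.1: ordinary multiple points; a product of
pairwise transversal smooth branches with no triple point has only nodes.]

## What is here

* `eval_cubic3`, `three_sq_sub_one_ne_zero_of_cubic` — the three lines `s³ − s = 0` (written `X 0 * (X 0 - 1) * (X 0 + 1)`);
* **`isNodal_cubic3_mul_X_one_mul`** — `(s³ − s)·y·Ψ` is nodal if `Ψ` is nodal, `Ψ(s, 0) ≠ 0`, and `∂_yΨ ≠ 0` wherever `Ψ = 0 = s³ − s`;
* **`isNodal_cubic3_mul`** — `(s³ − s)·Φ` is nodal if `Φ` is nodal and `∂_vΦ ≠ 0` wherever `Φ = 0 = s³ − s`.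

Honest scope: elementary; nothing here bears on HC; S1 ∕ K1Q NOT proved here.

## References
* [Fulton2008] W. Fulton, *Algebraic Curves* (2008), §3.1 (multiple points, tangent lines, ordinary multiple points, nodes).
-/

set_option autoImplicit false

noncomputable section

open MvPolynomial

namespace Literature.AlgebraicGeometry.HodgeTheory.Q8Family

open Literature.AlgebraicGeometry.PlaneCurves.SingularPointsEnvelopes Literature.AlgebraicGeometry.PlaneCurves.AffineNodalCurves

/-! ### The three lines `s³ − s = 0` -/

/-- `(s(s−1)(s+1))(p) = s(s−1)(s+1)`. [cite: Fulton2008, §3.1 (multiple points)] -/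
theorem eval_cubic3 (p : Fin 2 → ℂ) :
    MvPolynomial.eval p (X 0 * (X 0 - 1) * (X 0 + 1) : MvPolynomial (Fin 2) ℂ) = p 0 * (p 0 - 1) * (p 0 + 1) := by
  simp

/-- At a zero of `s(s−1)(s+1)`, `3s² − 1 ≠ 0` (the three lines are simple zeros of `s³ − s`). [cite: Fulton2008, §3.1 (simple points)] -/
theorem three_sq_sub_one_ne_zero_of_cubic {s : ℂ} (hs : s * (s - 1) * (s + 1) = 0) : 3 * s ^ 2 - 1 ≠ 0 := by
  rcases mul_eq_zero.1 hs with h | h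
  · rcases mul_eq_zero.1 h with h | h
    · rw [h]; norm_num
    · have : s = 1 := by linear_combination h
      rw [this]; norm_num
  · have : s = -1 := by linear_combination h
    rw [this]; norm_num

/-! ### The two configurations -/

/-- **`(s³ − s)·y·Ψ = 0` is nodal** provided `Ψ = 0` is nodal, misses the line `y = 0`, and `∂_yΨ ≠ 0` at its points on the lines
`s³ = s` (charts `U₁`, `U₂` of the S1 branch curve). [cite: Fulton2008, §3.1 (ordinary multiple points)] -/
theorem isNodal_cubic3_mul_X_one_mul {Ψ : MvPolynomial (Fin 2) ℂ} (hΨ : IsNodal Ψ)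
    (hE : ∀ p : Fin 2 → ℂ, p 1 = 0 → MvPolynomial.eval p Ψ ≠ 0)
    (hT : ∀ p : Fin 2 → ℂ, p 0 * (p 0 - 1) * (p 0 + 1) = 0 → MvPolynomial.eval p Ψ = 0 → grad Ψ p 1 ≠ 0) :
    IsNodal (X 0 * (X 0 - 1) * (X 0 + 1) * X 1 * Ψ) := by
  refine IsNodal.mul isNodal_cubic_mul_X_one hΨ fun p hLy hΨp => ?_
  have hy : p 1 ≠ 0 := fun hy => hE p hy hΨp
  rw [map_mul, eval_X, eval_cubic3] at hLy
  have hL : p 0 * (p 0 - 1) * (p 0 + 1) = 0 := (mul_eq_zero.1 hLy).resolve_right hy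
  have hg0 : grad (X 0 * (X 0 - 1) * (X 0 + 1) * X 1 : MvPolynomial (Fin 2) ℂ) p 0 = (3 * p 0 ^ 2 - 1) * p 1 := by
    rw [grad_mul_apply, grad_cubic, eval_X, eval_cubic3, hL, zero_mul, add_zero]
    simp
  have hg1 : grad (X 0 * (X 0 - 1) * (X 0 + 1) * X 1 : MvPolynomial (Fin 2) ℂ) p 1 = 0 := by
    rw [grad_mul_apply, grad_cubic, eval_cubic3, hL, zero_mul, add_zero]
    simp
  unfold jac
  rw [hg0, hg1, zero_mul, sub_zero]
  exact mul_ne_zero (mul_ne_zero (three_sq_sub_one_ne_zero_of_cubic hL) hy) (hT p hL hΨp)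

/-- **`(s³ − s)·Φ = 0` is nodal** provided `Φ = 0` is nodal and `∂_vΦ ≠ 0` at its points on the lines `s³ = s` (charts `U₃`, `U₄`).
[cite: Fulton2008, §3.1 (ordinary multiple points)] -/
theorem isNodal_cubic3_mul {Φ : MvPolynomial (Fin 2) ℂ} (hΦ : IsNodal Φ)
    (hT : ∀ p : Fin 2 → ℂ, p 0 * (p 0 - 1) * (p 0 + 1) = 0 → MvPolynomial.eval p Φ = 0 → grad Φ p 1 ≠ 0) :
    IsNodal (X 0 * (X 0 - 1) * (X 0 + 1) * Φ) := by
  refine IsNodal.mul isNodal_cubic hΦ fun p hL hΦp => ?_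
  rw [eval_cubic3] at hL
  have hj : jac (X 0 * (X 0 - 1) * (X 0 + 1) : MvPolynomial (Fin 2) ℂ) Φ p = (3 * p 0 ^ 2 - 1) * grad Φ p 1 := by
    unfold jac
    rw [grad_cubic]
    simp
  rw [hj]
  exact mul_ne_zero (three_sq_sub_one_ne_zero_of_cubic hL) (hT p hL hΦp)

/-- The same with the lines written as `s³ − s`. [cite: Fulton2008, §3.1 (ordinary multiple points)] -/
theorem isNodal_X_cube_sub_X_mul {Φ : MvPolynomial (Fin 2) ℂ} (hΦ : IsNodal Φ)
    (hT : ∀ p : Fin 2 → ℂ, p 0 * (p 0 - 1) * (p 0 + 1) = 0 → MvPolynomial.eval p Φ = 0 → grad Φ p 1 ≠ 0) :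
    IsNodal ((X 0 ^ 3 - X 0) * Φ) := by
  rw [show (X 0 ^ 3 - X 0 : MvPolynomial (Fin 2) ℂ) = X 0 * (X 0 - 1) * (X 0 + 1) by ring]
  exact isNodal_cubic3_mul hΦ hT

end Literature.AlgebraicGeometry.HodgeTheory.Q8Family

end
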